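import Summits.Ventures.LatticeQCDFlow.Scaling.TaggedPerAttemptCertificateGlobal
import Summits.Ventures.LatticeQCDFlow.Scaling.TaggedCostSideResidual
import Summits.Ventures.LatticeQCDFlow.Scaling.TaggedPerAttemptCertificateAboveGlobal

/-!
HONEST FRAMING: exact (Metropolis-corrected) sampling algorithms for lattice gauge theory; figures
of merit are autocorrelation/cost numbers at stated couplings and volumes; no continuum-physics
claim.

# TaggedPerAttemptCertificateAdjacentDepth — CONJECTURE W′ ON EVERY DEPTH-ADJACENT EDGE, FROM EVERY ORDINARY HUB, IN EVERY CONFIGURATION (TIES INCLUDED), EVERY `K ≥ 2`: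
# `L·(x̃(★) + (x̃(a) − ỹ(a)) − D_J) ≥ cost(x̃) + cost(ỹ)` FOR EVERY TRUNCATION `J` (lean-2 GEN-42, ours)

Venture-side (OURS).  Cell `lqcd-flow` (pub-lqcd), unit `pub-lqcd-lean-2-g42`, 2026-08-30.  Chapter AB (route (β), the cost side continued), file 11 — the assembly.  For W14∕W26's
tagged chains of an adjacent pair (`W_b ≤ W_a`, no PRESENT content strictly between `W_b` and `W_a`) from ANY ordinary hub `z` (`N_C(z) ≠ 0`), no further hypothesis: the hub is
either at or above `W_a` (file 10: `tagged_perAttempt_certificate_above_global`), or at most `W_b` (it is present, so not strictly between) and then either a third particle sits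
at or above `W_z` (file 6: `tagged_perAttempt_certificate_global`, the tie `W_w = W_z` included by file 4's tie-breaking enumeration) or `z` is alone with every other present
content strictly below it (file 7b: `tagged_perAttempt_certificate_residual`).

* **`tagged_perAttempt_certificate_adjacentDepth`**: `cost(x̃) + cost(ỹ) ≤ L·(x̃(★) + (x̃(a) − ỹ(a)) − D_J)` for every `J`, `L = 2K + M_X + M_Y`, `D_J = Σ_{n<J}(1−σ)σⁿ(y_{n+1}(z) − x_{n+1}(z))⁺`.

This is the per-attempt-count criterion of route (β) (MEMO-gen40 §4) on the edge class of GEN-40 §6; by GEN-41 §0(a) the class is not closed under the coupling, and files 6 ∕ 10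
already hold on every edge; what is missing for EVERY edge is the hub strictly between `W_b` and `W_a` (file 12: with a third particle at or above it; alone: open).  Literature grade
(cell rule): OWN; nothing cited; no new bib keys.
-/

open Finset

namespace Summit.Ventures.LatticeQCDFlow.Scaling

section AdjacentDepth
variable {S : Type*} [Fintype S] [DecidableEq S]
variable {W θ : S → ℝ} {acc : S → S → ℝ} {p : ℝ} {K : ℕ} {NC : S → ℕ} {a b : S} {PX PY : Option S → Option S → ℝ}

/-- **CONJECTURE W′ ON EVERY DEPTH-ADJACENT EDGE, EVERY CONFIGURATION, EVERY `K ≥ 2`** (see the module docstring). [ours] -/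
theorem tagged_perAttempt_certificate_adjacentDepth (hW : ∀ v, 0 < W v) (hp0 : 0 ≤ p) (hp : ∀ v, p * W v ≤ 1) (hθ : ∀ v, θ v = 1 / (1 + p * W v))
    (hacc : ∀ h v, acc h v = min 1 (W h / W v)) (hK : 2 ≤ K) (hNC : ∑ v, NC v = K) (hab : W b ≤ W a)
    (hPXoff : ∀ h v, h ≠ v → PX (some h) (some v) = if NC h = 0 then 0 else (NC v : ℝ) / K * acc h v)
    (hPXin : ∀ h, PX (some h) none = if NC h = 0 then 0 else acc h a / K)
    (hPXdiag : ∀ h, PX (some h) (some h) = 1 - (∑ v ∈ univ.erase h, PX (some h) (some v) + PX (some h) none))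
    (hPXout : ∀ v, PX none (some v) = (NC v : ℝ) / K * acc a v) (hPXstay : PX none none = 1 - ∑ v, PX none (some v))
    (hPYoff : ∀ h v, h ≠ v → PY (some h) (some v) = if NC h = 0 then 0 else (NC v : ℝ) / K * acc h v)
    (hPYin : ∀ h, PY (some h) none = if NC h = 0 then 0 else acc h b / K)
    (hPYdiag : ∀ h, PY (some h) (some h) = 1 - (∑ v ∈ univ.erase h, PY (some h) (some v) + PY (some h) none))
    (hPYout : ∀ v, PY none (some v) = (NC v : ℝ) / K * acc b v) (hPYstay : PY none none = 1 - ∑ v, PY none (some v))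
    (hnone : ∀ w, NC w ≠ 0 → ¬ (W b < W w ∧ W w < W a)) {z : S} (hz : NC z ≠ 0)
    {x y : ℕ → Option S → ℝ}
    (hx0 : ∀ v, x 0 v = if v = some z then 1 else 0) (hxs : ∀ n v, x (n + 1) v = ∑ h, x n h * PX h v)
    (hy0 : ∀ v, y 0 v = if v = some z then 1 else 0) (hys : ∀ n v, y (n + 1) v = ∑ h, y n h * PY h v)
    {M : ℝ} (hM : M = ∑ v, θ v * (NC v : ℝ) + θ a) {L : ℝ} (hL : L = 2 * K + M + (∑ v, θ v * (NC v : ℝ) + θ b))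
    {σ : ℝ} (hσ0 : 0 ≤ σ) (hσ1 : σ < 1) {xt yt xs ys : Option S → ℝ}
    (hxt : ∀ t, xt t = (1 - σ) * PX (some z) t + σ * ∑ t', xt t' * PX t' t) (hyt : ∀ t, yt t = (1 - σ) * PY (some z) t + σ * ∑ t', yt t' * PY t' t)
    (hxsr : ∀ t, xs t = (1 - σ) * PX none t + σ * ∑ t', xs t' * PX t' t) (hysr : ∀ t, ys t = (1 - σ) * PY none t + σ * ∑ t', ys t' * PY t' t) (J : ℕ) :
    (∑ v, xt (some v) * (1 - θ v) + xt none * (1 - θ a)) + (∑ v, yt (some v) * (1 - θ v) + yt none * (1 - θ b))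
      ≤ L * (xt none + (xt (some a) - yt (some a)) - ∑ n ∈ range J, (1 - σ) * σ ^ n * max 0 (y (n + 1) (some z) - x (n + 1) (some z))) := by
  by_cases haz : W a ≤ W z
  · -- the hub at or above `W_a` (file 10; the tie included)
    exact tagged_perAttempt_certificate_above_global hW hp0 hp hθ hacc hK hNC hab hPXoff hPXin hPXdiag hPXout hPXstay hPYoff hPYin hPYdiag hPYout hPYstay
      hz haz hx0 hxs hy0 hys hM hL hσ0 hσ1 hxt hyt hxsr hysr J
  · have hza : W z < W a := lt_of_not_ge haz
    -- a present hub is not strictly between the extra particles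
    have hzb : W z ≤ W b := by
      by_contra h
      exact hnone z hz ⟨lt_of_not_ge h, hza⟩
    by_cases hthree : 2 ≤ NC z ∨ ∃ w, w ≠ z ∧ NC w ≠ 0 ∧ W z ≤ W w
    · -- three particles at or above `z` (file 6; ties included)
      exact tagged_perAttempt_certificate_global hW hp0 hp hθ hacc hK hNC hab hPXoff hPXin hPXdiag hPXout hPXstay hPYoff hPYin hPYdiag hPYout hPYstay
        hz hzb hza hthree hx0 hxs hy0 hys hM hL hσ0 hσ1 hxt hyt hxsr hysr J
    · -- the residual pair (file 7b)
      have hz2 : ¬ 2 ≤ NC z := fun h => hthree (Or.inl h)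
      have hz1 : NC z = 1 := by omega
      have hbelow : ∀ w, w ≠ z → NC w ≠ 0 → W w < W z := fun w hwz hNw =>
        lt_of_not_ge fun hle => hthree (Or.inr ⟨w, hwz, hNw, hle⟩)
      exact tagged_perAttempt_certificate_residual hW hp0 hp hθ hacc hK hNC hab hnone hPXoff hPXin hPXdiag hPXout hPXstay hPYoff hPYin hPYdiag hPYout hPYstay
        hz1 hzb hza hbelow hx0 hxs hy0 hys hM hL hσ0 hσ1 hxt hyt hxsr hysr J

end AdjacentDepth

end Summit.Ventures.LatticeQCDFlow.Scaling
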